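import Summits.BirchSwinnertonDyer.BirchSwinnertonDyer.Theses.CongruentShaFreeCut
import Literature.NumberTheory.EllipticCurves.Monsky1990.MockHeegnerCongruentNumbers

/-! # Route `CongruentShaFreeCut` (rung S2) — definitions the route posits for crux
`RankPosOfTwoSelmerCorankOne` (stmt-BirchSwinnertonDyer-19079): the Monsky-uncovered family `W`, the
rung Prop on `W` and its s-case Prop (tribunal identifiers)

The BC5 rung of the residual crux A is LANDED def-free in `Theorems/CongruentShaFreeCutRungMonsky.lean`
(`rung_monskyUncovered`, modulo the refereed fact `Monsky1990.cor515_rank_eq_one_and_card_selmerGroup_two`).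
The tribunal kernel consumes a rung as IDENTIFIERS — `--witness <fq theorem>` and `--s-case <decl stating
the S-restricted case>` (cell INBOX 2026-08-25T23:22–23:33Z; precedent: crux B's
`…Theorems.CongruentShaFreeCutRungSupersingular.stub_rung_supersingular` with s-case
`BurungaleKobayashiOta2024.thm15_…`). This file supplies those identifiers in exactly the shapes the
cell's referee ledger fixed (GAP-LEDGER-read2-monsky-g29 §D.1 / §E, frozen sha256 1eab0906…; adopted
VERDICT Part IX-D §4 (a)):
* `IsMonskyUncoveredFamily N` — `N = 2pq` with `p, q` prime, (`p ≡ 3, q ≡ 5 (mod 8)` or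
  `p ≡ 5, q ≡ 7 (mod 8)`) and `(p/q) = −1`: the two class-`6` halves of Monsky 1990 Cor. 5.15 group (2)
  on which `ord_{s=1} L(E_N, s) = 1` is NOT in print (Tian–Yuan–Zhang 2017 Thm 1.2 class-`6` criterion
  silent: `Σ₂′` even; Tian 2014 / Li–Liu–Tian 2024 exclude structurally). Reciprocity note: in both
  cells one of `p, q` is `≡ 1 (mod 4)`, so `(p/q) = (q/p)` — the anchoring order is immaterial.
* `RankPosOnMonskyUncovered` — crux A VERBATIM restricted to `W` (the WITNESS statement; proved here
  modulo the Monsky fact: `rankPosOnMonskyUncovered_of_cor515`, and a literal consequence of the crux: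
  `rankPosOnMonskyUncovered_of_crux`).
* `AnalyticRankOneOnMonskyUncovered` — the rung-leaf `rankOne_twoConverse_congruentNumber` restricted to
  `W` (the S-CASE; a literal consequence of the leaf: `analyticRankOneOnMonskyUncovered_of_leaf`; NOT
  provable from print on `W` — ledger §B — which is the separation T3 asks for). Its hypothesis-free
  form `AnalyticRankOneOnMonskyUncovered'` (read2 §E's display) is equivalent modulo the Monsky fact
  (`analyticRankOneOnMonskyUncovered_iff`), since `corank₂ = 1` HOLDS on `W`.
Nothing is asserted; no axiom, no instance, no notation; the three closed Props carry `@[conjecture]`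
(obligation nodes: the witness is closed modulo the Monsky fact in this file, the s-case is OPEN). HONEST FRAMING: a closed rung closes nothing of
BSD; crux A stays the route's declared residual.
-/

namespace Summit.BirchSwinnertonDyer.BirchSwinnertonDyer.Theorems.CongruentShaFreeCutDefs

open Literature.NumberTheory.EllipticCurves Literature.NumberTheory.EllipticCurves.Monsky1990
open Summit.BirchSwinnertonDyer.BirchSwinnertonDyer.Theses.CongruentShaFreeCut
open WeierstrassCurve

/-- **The Monsky-uncovered family `W`** (GAP-LEDGER-read2-monsky-g29 §D.1, the shape adopted in VERDICT
IX-D §4 (a)): `N = 2pq`, `p, q` prime, `p ≡ 3 ∧ q ≡ 5 (mod 8)` or `p ≡ 5 ∧ q ≡ 7 (mod 8)`, and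
`(p/q) = −1` (Mathlib's `jacobiSym`). Members: `30, 70, 174, 230, 318, 470, …` (all `≡ 6 (mod 8)`). -/
def IsMonskyUncoveredFamily (N : ℕ) : Prop :=
  ∃ p q : ℕ, p.Prime ∧ q.Prime ∧ (p % 8 = 3 ∧ q % 8 = 5 ∨ p % 8 = 5 ∧ q % 8 = 7) ∧
    jacobiSym p q = -1 ∧ N = 2 * (p * q)

/-- **The rung statement (WITNESS) for crux A on `W`**: `RankPosOfTwoSelmerCorankOne` verbatim with
`n` restricted to `IsMonskyUncoveredFamily` (the `n ≠ 0` guard of the crux is automatic on `W`). -/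
@[conjecture] def RankPosOnMonskyUncovered : Prop :=
  ∀ ⦃N : ℕ⦄, IsMonskyUncoveredFamily N → (congruentNumberCurve N).selmerCorank 2 = 1 →
    1 ≤ (congruentNumberCurve N).mordellWeilRank

/-- **The S-CASE for the rung**: the rung-leaf `rankOne_twoConverse_congruentNumber` (rank-one
`2`-converse, `corank_{ℤ₂} Sel_{2^∞}(E_N) = 1 ⟹ ord_{s=1} L(E_N, s) = 1`) verbatim restricted to `W`.
NOT a theorem in print on `W` (GAP-LEDGER-read2-monsky-g29 §B: TYZ 2017 class-`6` criterion silent,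
Tian 2014 / LLT 2024 exclude; sweep null) — typed as a statement only, for `--s-case`. -/
@[conjecture] def AnalyticRankOneOnMonskyUncovered : Prop :=
  ∀ ⦃N : ℕ⦄, IsMonskyUncoveredFamily N → (congruentNumberCurve N).selmerCorank 2 = 1 →
    (congruentNumberCurve N).analyticRank = 1

/-- **Hypothesis-free display of the S-case** (GAP-LEDGER-read2-monsky-g29 §E verbatim shape):
`∀ N ∈ W, ord_{s=1} L(E_N, s) = 1`. Equivalent to `AnalyticRankOneOnMonskyUncovered` modulo the Monsky
fact (`analyticRankOneOnMonskyUncovered_iff`). -/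
@[conjecture] def AnalyticRankOneOnMonskyUncovered' : Prop :=
  ∀ ⦃N : ℕ⦄, IsMonskyUncoveredFamily N → (congruentNumberCurve N).analyticRank = 1

namespace IsMonskyUncoveredFamily

/-- `W ⊂` Monsky's Cor. 5.15 families (group (2): `2p₅p₃` / `2p₅p₇`, tree disjunct 4 of
`Monsky1990.IsCor515Family`; membership needs no symbol). -/
theorem isCor515Family {N : ℕ} (h : IsMonskyUncoveredFamily N) : IsCor515Family N := by
  obtain ⟨p, q, hp, hq, h8, -, rfl⟩ := h
  rcases h8 with ⟨hp8, hq8⟩ | ⟨hp8, hq8⟩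
  · exact Or.inr (Or.inr (Or.inr (Or.inl ⟨q, p, hq, hp, hq8, Or.inl hp8, by rw [Nat.mul_comm p q]⟩)))
  · exact Or.inr (Or.inr (Or.inr (Or.inl ⟨p, q, hp, hq, hp8, Or.inr hq8, rfl⟩)))

/-- Members of `W` are non-zero (so `congruentNumberCurve N` is elliptic). -/
theorem ne_zero {N : ℕ} (h : IsMonskyUncoveredFamily N) : N ≠ 0 := h.isCor515Family.ne_zero

/-- Members of `W` are square-free. -/
theorem squarefree {N : ℕ} (h : IsMonskyUncoveredFamily N) : Squarefree N :=
  h.isCor515Family.squarefree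

/-- Members of `W` are `≡ 6 (mod 8)` (root number `−1`: `ord_{s=1} L(E_N, s)` is odd for free; what is
missing in print on `W` is `L′(E_N, 1) ≠ 0`). -/
theorem mod_eight {N : ℕ} (h : IsMonskyUncoveredFamily N) : N % 8 = 6 := by
  obtain ⟨p, q, -, -, h8, -, rfl⟩ := h
  rw [Nat.mul_mod, Nat.mul_mod p q]
  rcases h8 with ⟨hp8, hq8⟩ | ⟨hp8, hq8⟩ <;> simp [hp8, hq8]

/-- `30 = 2·3·5 ∈ W` (`(3/5) = −1`). -/
theorem thirty : IsMonskyUncoveredFamily 30 :=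
  ⟨3, 5, Nat.prime_three, Nat.prime_five, Or.inl ⟨rfl, rfl⟩, by norm_num [jacobiSym], rfl⟩

/-- `70 = 2·5·7 ∈ W` (`(5/7) = −1`). -/
theorem seventy : IsMonskyUncoveredFamily 70 :=
  ⟨5, 7, Nat.prime_five, by norm_num, Or.inr ⟨rfl, rfl⟩, by norm_num [jacobiSym], rfl⟩

end IsMonskyUncoveredFamily

/-- **On `W` the crux's hypothesis HOLDS** — `corank_{ℤ₂} Sel_{2^∞}(E_N/ℚ) = 1` (rank `1`, `Ш[2^∞] = 0`,
corank identity), modulo the Monsky fact: the rung is non-vacuous. -/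
theorem selmerCorank_two_eq_one_of_isMonskyUncoveredFamily
    (hM : cor515_rank_eq_one_and_card_selmerGroup_two) {N : ℕ} (h : IsMonskyUncoveredFamily N) :
    (congruentNumberCurve N).selmerCorank 2 = 1 :=
  selmerCorank_two_eq_one_of_cor515 hM h.isCor515Family

/-- **The WITNESS, proved**: `RankPosOnMonskyUncovered` modulo the refereed Monsky fact (rank `= 1` on
all of Cor. 5.15 group (2); the symbol / corank clauses only restrict the statement). The def-free twin
is `…Theorems.CongruentShaFreeCutRungMonsky.rung_monskyUncovered`. -/
theorem rankPosOnMonskyUncovered_of_cor515 (hM : cor515_rank_eq_one_and_card_selmerGroup_two) :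
    RankPosOnMonskyUncovered := by
  intro N hN _
  haveI := isElliptic_congruentNumberCurve hN.ne_zero
  exact (hM N hN.isCor515Family).1.ge

/-- The witness statement is a LITERAL RESTRICTION of crux A (so it is implied by the crux; pure logic). -/
theorem rankPosOnMonskyUncovered_of_crux (hA : RankPosOfTwoSelmerCorankOne) :
    RankPosOnMonskyUncovered :=
  fun _ hN hc => hA hN.ne_zero hc

/-- The s-case is a LITERAL RESTRICTION of the rung-leaf `rankOne_twoConverse_congruentNumber`
(pure logic; the leaf is the cell's ONE open binder, so this proves nothing about `W`). -/
theorem analyticRankOneOnMonskyUncovered_of_leaf (hT : rankOne_twoConverse_congruentNumber) :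
    AnalyticRankOneOnMonskyUncovered :=
  fun _ hN hc => hT hN.ne_zero hc

/-- The two displays of the s-case agree modulo the Monsky fact (the corank hypothesis holds on `W`). -/
theorem analyticRankOneOnMonskyUncovered_iff (hM : cor515_rank_eq_one_and_card_selmerGroup_two) :
    AnalyticRankOneOnMonskyUncovered ↔ AnalyticRankOneOnMonskyUncovered' :=
  ⟨fun h _ hN => h hN (selmerCorank_two_eq_one_of_isMonskyUncoveredFamily hM hN),
    fun h _ hN _ => h hN⟩

/-! ## Appendix (plan g11, 2026-08-26): the judge's informative S-case for crux B's supersingular rung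

Tribunal identifier only (`tribunal_fit.s_case`); nothing asserted. Twin of
`MordellShaFreeCutDefs.RefinedPConverseSupersingularOnMordell` (p425535). -/

/-- **BKO 2024 display (1.6) / Remark 1.6 (ii) — the REFINED supersingular `p`-converse, restricted to the
congruent number curves** `E_n : y² = x³ − n²x` (`j = 1728`, CM by `ℤ[i]`) at a good supersingular prime
`p ≥ 5` (`p ≡ 3 (mod 4)`, `p ∤ n`, `n` square-free): `corank_{ℤ_p} Sel_{p^∞}(E_n) = 1 ⟹ ord_{s=1} L(E_n, s) = 1`.
This is the S-restricted case in the regime of the landed BC5 rung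
`CongruentShaFreeCutRungSupersingular.stub_rung_supersingular` (p410927; rung = this statement with the
corank hypothesis replaced by `rank = 1 ∧ #Ш[p^∞] < ∞`, modulo Burungale–Kobayashi–Ota 2024 Thm. 1.5).
OPEN in print: Thm. 1.5 as printed CARRIES the `Ш[p^∞]`-clause and Remark 1.6 (ii) names (1.6) as the
refinement one "may seek" (tree docstring `BurungaleKobayashiOta2024/SupersingularPConverse.lean`, citation
header); so the rung lies outside S's known regime exactly by the Ш-clause that crux B isolates
(`rung_of_refinedPConverseOnCongruent`). [cite: BurungaleKobayashiOta2023, Thm. 1.5 (p. 1422), Rem. 1.6 (ii)] -/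
@[conjecture] def RefinedPConverseSupersingularOnCongruent : Prop :=
  ∀ ⦃n : ℕ⦄, Squarefree n → ∀ ⦃p : ℕ⦄, p.Prime → 5 ≤ p → p % 4 = 3 → ¬ p ∣ n →
    (congruentNumberCurve n).selmerCorank p = 1 → (congruentNumberCurve n).analyticRank = 1

/-- **The S-case dominates the rung** (bookkeeping: `selmerCorank = rank + shaCorank`, `shaCorank = 0 ⟺ Ш[p^∞]`
finite): under the rung's hypotheses the corank is `1`, so the refined converse returns the rung's conclusion
WITHOUT the BKO fact binder. -/
theorem rung_of_refinedPConverseOnCongruent (h : RefinedPConverseSupersingularOnCongruent)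
    {n : ℕ} (hn : Squarefree n) {p : ℕ} [Fact p.Prime] (hp : 5 ≤ p) (hp4 : p % 4 = 3)
    (hpn : ¬ p ∣ n) (hrank : (congruentNumberCurve n).mordellWeilRank = 1)
    (hsha : Finite (AddCommGroup.primaryComponent (congruentNumberCurve n).sha p)) :
    (congruentNumberCurve n).analyticRank = 1 := by
  haveI := isElliptic_congruentNumberCurve hn.ne_zero
  have hadd := (congruentNumberCurve n).selmerCorank_eq_mordellWeilRank_add_holds p
  have hsha0 : (congruentNumberCurve n).shaCorank p = 0 :=
    (finite_primaryComponent_sha_iff_shaCorank_eq_zero _ p).1 hsha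
  exact h hn (Fact.out) hp hp4 hpn (by omega)

end Summit.BirchSwinnertonDyer.BirchSwinnertonDyer.Theorems.CongruentShaFreeCutDefs
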